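import Mathlib
import Literature.Combinatorics.SimpleGraph.PerfectMatchingPoly
import Summits.PneNP.PneNP.Theses.ConvexRankGates
import Summits.PneNP.PneNP.Theorems.ConvexRankGatesThetaGateKillsRazborovPair

/-!
# Route ConvexRankGates — support item `BpmIsOneRankGate` (stmt-PneNP-2665)

`Summit.PneNP.PneNP.Theses.ConvexRankGates.BpmIsOneRankGate`: bipartite perfect matching on
`Fin n × Fin n` (one Boolean variable per position `(i, j)`, output: the selected positions
support a permutation) is computed by a circuit consisting of ONE symbolic-rank (GRANK) gate of
dimension `n`: field `F = ℚ`, `d = θ = n`, `K₀ = 0`, `K_(i,j) = E_ij`.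

Proof. The gate matrix `Σ_{selected (i,j)} x_(i,j) E_ij` over `Frac(ℚ[x])` is the image of the
Edmonds matrix `edmondsMatrix G ℚ` (`Literature/Combinatorics/SimpleGraph/PerfectMatchingPoly`)
of the selected position set `G` under the injective ring map `Frac ∘ rename`
(`bpm_gateMatrix_eq`); an `n × n` matrix over a field has rank `≥ n` iff its determinant is
non-zero (`le_rank_iff_det_ne_zero_of_sq`); and the determinant of the Edmonds matrix is non-zero
iff `G` has a perfect matching (`det_edmondsMatrix_ne_zero_iff`, Edmonds 1967: `→` by the Leibniz
expansion — every permutation term has a zero factor; `←` by evaluating at the indicator of a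
perfect matching `τ`, which turns the Edmonds matrix into the permutation matrix of `τ`, of
determinant `sign τ ≠ 0`).

References: J. Edmonds, *Systems of distinct representatives and linear algebra*, J. Res. NBS
71B (1967) 241–245, §3; R. Motwani, P. Raghavan, *Randomized Algorithms* (1995), §7.3 Thm. 7.3.
-/

namespace Summit.PneNP.PneNP.Theorems

open Literature.Computability.Complexity Literature.Combinatorics.SimpleGraph Matrix

section Bpm

/-- **Edmonds' theorem, determinant form.** Over a nontrivial commutative ring, the determinant
of the Edmonds matrix of `G ⊆ V × V` is non-zero iff `G` has a perfect matching, i.e. iff some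
permutation `σ` of `V` has all `(i, σ i) ∈ G`. [cite: Edmonds1967, §3; MotwaniRaghavan1995,
§7.3 Thm. 7.3] -/
theorem det_edmondsMatrix_ne_zero_iff {V : Type*} [DecidableEq V] [Fintype V] (G : Finset (V × V))
    (R : Type*) [CommRing R] [Nontrivial R] :
    (edmondsMatrix G R).det ≠ 0 ↔ ∃ σ : Equiv.Perm V, ∀ i, (i, σ i) ∈ G := by
  constructor
  · intro h
    by_contra hno
    push Not at hno
    apply h
    -- Leibniz expansion of `det = det ∘ transpose`: every term has a zero factor
    rw [← Matrix.det_transpose, Matrix.det_apply]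
    refine Finset.sum_eq_zero fun σ _ => ?_
    obtain ⟨i, hi⟩ := hno σ
    have h0 : (edmondsMatrix G R)ᵀ (σ i) i = 0 := by
      simp [Matrix.transpose_apply, edmondsMatrix_apply, hi]
    rw [Finset.prod_eq_zero (f := fun j => (edmondsMatrix G R)ᵀ (σ j) j) (Finset.mem_univ i) h0,
      smul_zero]
  · rintro ⟨τ, hτ⟩ h
    -- evaluate at the indicator of the matching `τ`: the Edmonds matrix becomes the permutation
    -- matrix of `τ`
    let w : V × V → R := fun e => if τ e.1 = e.2 then 1 else 0
    have hM : (MvPolynomial.eval w).mapMatrix (edmondsMatrix G R) = τ.permMatrix R := by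
      ext i j
      simp only [RingHom.mapMatrix_apply, Matrix.map_apply, edmondsMatrix_apply,
        Equiv.Perm.permMatrix, PEquiv.toMatrix_apply, Equiv.toPEquiv_apply, Option.mem_def,
        Option.some.injEq]
      by_cases hij : τ i = j
      · subst hij
        simp [w, hτ i]
      · rw [if_neg hij]
        split_ifs
        · simp [w, hij]
        · simp
    have hdet := RingHom.map_det (MvPolynomial.eval w) (edmondsMatrix G R)
    rw [h, map_zero, hM, Matrix.det_permutation] at hdet
    rcases Int.units_eq_one_or (Equiv.Perm.sign τ) with hs | hs
    · rw [hs] at hdet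
      simp at hdet
    · rw [hs] at hdet
      simp at hdet

/-- A square matrix over a field has full rank iff its determinant is non-zero. [folklore] -/
theorem le_rank_iff_det_ne_zero_of_sq {K : Type*} [Field K] {n : ℕ}
    (A : Matrix (Fin n) (Fin n) K) : n ≤ A.rank ↔ A.det ≠ 0 := by
  constructor
  · intro h hdet
    have hr : A.rank = n := le_antisymm (Matrix.rank_le_width A) h
    have htop : LinearMap.range A.mulVecLin = ⊤ := by
      apply Submodule.eq_top_of_finrank_eq
      rw [Module.finrank_fin_fun]
      exact hr
    have hsurj : Function.Surjective A.mulVec := fun v => by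
      obtain ⟨u, hu⟩ := LinearMap.range_eq_top.1 htop v
      exact ⟨u, hu⟩
    have hU : IsUnit A := Matrix.mulVec_surjective_iff_isUnit.1 hsurj
    exact ((Matrix.isUnit_iff_isUnit_det A).1 hU).ne_zero hdet
  · intro h
    have hU : IsUnit A := (Matrix.isUnit_iff_isUnit_det A).2 (isUnit_iff_ne_zero.2 h)
    have := Matrix.rank_of_isUnit A hU
    rw [Fintype.card_fin] at this
    exact this.ge

/-- The GRANK gate matrix of bipartite matching: with `K₀ = 0` and `K_a = E_(w a)` (`w` an
enumeration of `Fin n × Fin n`), the symbolic matrix `K₀ + Σ_{a selected} x_a K_a` over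
`Frac(F[x])` is the image of the Edmonds matrix of the selected positions under
`Frac ∘ rename`. [folklore] -/
theorem bpm_gateMatrix_eq {F : Type*} [Field F] {n N : ℕ} (e : Fin n × Fin n ≃ Fin N)
    (x : Fin n × Fin n → Bool) :
    (0 : Matrix (Fin n) (Fin n) F).map (algebraMap F (FractionRing (MvPolynomial (Fin N) F))) +
      ∑ a : Fin N, (if x (e.symm a) then
        (algebraMap (MvPolynomial (Fin N) F) (FractionRing (MvPolynomial (Fin N) F))
          (MvPolynomial.X a)) •
          (Matrix.single (e.symm a).1 (e.symm a).2 (1 : F)).map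
            (algebraMap F (FractionRing (MvPolynomial (Fin N) F)))
        else 0) =
      ((algebraMap (MvPolynomial (Fin N) F) (FractionRing (MvPolynomial (Fin N) F))).comp
        (MvPolynomial.rename e : MvPolynomial (Fin n × Fin n) F →ₐ[F]
          MvPolynomial (Fin N) F).toRingHom).mapMatrix
        (edmondsMatrix (Finset.univ.filter fun p => x p = true) F) := by
  ext i j
  rw [Matrix.add_apply, Matrix.map_apply, Matrix.zero_apply, map_zero, zero_add, Matrix.sum_apply,
    RingHom.mapMatrix_apply, Matrix.map_apply, edmondsMatrix_apply]
  rw [Fintype.sum_equiv e.symm _ (fun p : Fin n × Fin n => (if x p then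
        (algebraMap (MvPolynomial (Fin N) F) (FractionRing (MvPolynomial (Fin N) F))
          (MvPolynomial.X (e p))) •
          (Matrix.single p.1 p.2 (1 : F)).map
            (algebraMap F (FractionRing (MvPolynomial (Fin N) F)))
        else 0) i j) (fun a => by simp)]
  rw [Finset.sum_eq_single (i, j)]
  · simp only [Finset.mem_filter, Finset.mem_univ, true_and, RingHom.coe_comp,
      Function.comp_apply]
    by_cases hx : x (i, j) = true
    · simp [hx, MvPolynomial.rename_X]
    · simp [hx]
  · rintro ⟨i', j'⟩ - hne
    by_cases hx : x (i', j') = true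
    · have hne' : ¬ (i' = i ∧ j' = j) := fun h' => hne (Prod.ext h'.1 h'.2)
      simp [hx, Matrix.single_apply_of_ne (h := hne')]
    · simp [hx]
  · intro h
    exact absurd (Finset.mem_univ _) h

/-- **The matching gate.** For the GRANK data `F`, `d = θ = n`, `K₀ = 0`, `K_a = E_(w a)`:
`n ≤ rank (Σ_{a selected} x_a E_(w a))` over `Frac(F[x])` iff the selected positions support a
permutation (Edmonds 1967). [cite: Edmonds1967, §3] -/
theorem bpm_gate_iff {F : Type*} [Field F] {n N : ℕ} (e : Fin n × Fin n ≃ Fin N)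
    (x : Fin n × Fin n → Bool) :
    n ≤ ((0 : Matrix (Fin n) (Fin n) F).map (algebraMap F (FractionRing (MvPolynomial (Fin N) F))) +
      ∑ a : Fin N, (if x (e.symm a) then
        (algebraMap (MvPolynomial (Fin N) F) (FractionRing (MvPolynomial (Fin N) F))
          (MvPolynomial.X a)) •
          (Matrix.single (e.symm a).1 (e.symm a).2 (1 : F)).map
            (algebraMap F (FractionRing (MvPolynomial (Fin N) F)))
        else 0)).rank ↔ ∃ σ : Equiv.Perm (Fin n), ∀ i, x (i, σ i) = true := by
  have hφ : Function.Injective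
      ((algebraMap (MvPolynomial (Fin N) F) (FractionRing (MvPolynomial (Fin N) F))).comp
        (MvPolynomial.rename e : MvPolynomial (Fin n × Fin n) F →ₐ[F]
          MvPolynomial (Fin N) F).toRingHom) :=
    (IsFractionRing.injective (MvPolynomial (Fin N) F) (FractionRing (MvPolynomial (Fin N) F))).comp
      (MvPolynomial.rename_injective e e.injective)
  rw [le_rank_iff_det_ne_zero_of_sq, bpm_gateMatrix_eq, ← RingHom.map_det, map_ne_zero_iff _ hφ,
    det_edmondsMatrix_ne_zero_iff]
  simp

/-- **One GRANK gate for bipartite matching, over any field `F`.** There are `N = n²` gate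
inputs, gate data `K₀ = 0`, `K_a = E_(w a)` (`w` the standard enumeration of `Fin n × Fin n`),
threshold `θ = n`, and a size-`1` circuit wiring input `a` to position `w a`; the gate accepts
`v` iff `n ≤ rank (Σ_{v_a = 1} x_a K_a)` over `Frac(F[x])`, and the circuit computes bipartite
perfect matching. (Stated for a field parameter `F` so that every instance on `Frac(F[x])` is
the generic one of the route's gate class.) [cite: Edmonds1967, §3] -/
theorem bpm_circuit (F : Type) [Field F] (n : ℕ) :
    ∃ (N : ℕ) (f : (Fin N → Bool) → Bool) (K : Fin N → Matrix (Fin n) (Fin n) F)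
      (C : Circuit (Fin n × Fin n)),
      (∀ B : Set GateFn, (⟨N, f⟩ : GateFn) ∈ B → C.IsOver B) ∧ C.size = 1 ∧
      (∀ v : Fin N → Bool, f v = true ↔ n ≤ ((0 : Matrix (Fin n) (Fin n) F).map
          (algebraMap F (FractionRing (MvPolynomial (Fin N) F))) +
        ∑ a : Fin N, (if v a then
          (algebraMap (MvPolynomial (Fin N) F) (FractionRing (MvPolynomial (Fin N) F))
            (MvPolynomial.X a)) •
            (K a).map (algebraMap F (FractionRing (MvPolynomial (Fin N) F)))
          else 0)).rank) ∧
      C.Computes (fun v => decide (∃ σ : Equiv.Perm (Fin n), ∀ i, v (i, σ i) = true)) := by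
  let N : ℕ := Fintype.card (Fin n × Fin n)
  let e : Fin n × Fin n ≃ Fin N := Fintype.equivFin _
  -- the gate data: `K₀ = 0`, `K_a = E_(w a)`, `θ = d = n`
  let K : Fin N → Matrix (Fin n) (Fin n) F := fun a => Matrix.single (e.symm a).1 (e.symm a).2 1
  let f : (Fin N → Bool) → Bool := fun v => decide (n ≤ ((0 : Matrix (Fin n) (Fin n) F).map
          (algebraMap F (FractionRing (MvPolynomial (Fin N) F))) +
        ∑ a : Fin N, (if v a then
          (algebraMap (MvPolynomial (Fin N) F) (FractionRing (MvPolynomial (Fin N) F))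
            (MvPolynomial.X a)) •
            (K a).map (algebraMap F (FractionRing (MvPolynomial (Fin N) F)))
          else 0)).rank)
  obtain ⟨C, hCover, hCsize, hCeval⟩ := exists_oneGate_circuit N f e.symm
  refine ⟨N, f, K, C, hCover, hCsize, fun v => decide_eq_true_iff, fun x => ?_⟩
  rw [hCeval]
  simp only [f, decide_eq_decide]
  exact bpm_gate_iff e x

/-- **`BpmIsOneRankGate`** (route ConvexRankGates, stmt-PneNP-2665): bipartite perfect matching
on `Fin n × Fin n` is computed by a size-`1` circuit whose single gate is a GRANK gate of
dimension `n` — `F = ℚ`, `d = θ = n`, `K₀ = 0`, `K_(i,j) = E_ij`: the symbolic matrix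
`Σ_{selected (i,j)} x_(i,j) E_ij` has rank `n` over `Frac(ℚ[x])` iff its determinant (the
signed perfect-matching polynomial) is non-zero iff a perfect matching is selected.
[cite: Edmonds1967, §3; MotwaniRaghavan1995, §7.3 Thm. 7.3] -/
theorem bpmIsOneRankGate_proof :
    Summit.PneNP.PneNP.Theses.ConvexRankGates.BpmIsOneRankGate := by
  unfold Summit.PneNP.PneNP.Theses.ConvexRankGates.BpmIsOneRankGate
  dsimp only
  intro n
  obtain ⟨N, f, K, C, hCover, hCsize, hf, hCcomp⟩ := bpm_circuit ℚ n
  exact ⟨C, hCover _ ⟨ℚ, inferInstance, n, n, le_rfl, _, K, hf⟩, hCsize, hCcomp⟩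

end Bpm

end Summit.PneNP.PneNP.Theorems
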